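import Summits.HubbardSuperconductivity.HubbardSuperconductivity.Theorems.AnisotropyChordTransferFibre3C0Layer
import Summits.HubbardSuperconductivity.HubbardSuperconductivity.Theorems.AnisotropyChordTransferFibre3TwoMagnonQF

/-!
# Route `AnisotropyChord` / H0 rotor rung: PartN41-C §4 — the SHELL CANCELLATION `C0ShellForm` (content, `L ≥ 3`)

Theory-1 g22's PartN41-C §4 `C0ShellForm` (port …Fibre3KT2bRow pending review): from `C0Explicit` (`c0Explicit_holds`) at
`a = x̂`, `c = b − x̂`, the two terms carrying the hard-core jump `D_{x̂}f(x̂) = D^{(+x̂)}f(x̂)` combine with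
`½f_nn(D_{x̂}f(b))²` to zero, leaving
`C0(x̂,b) = ½f_nn(D_{x̂}f(b))² − ½f_nn Σ_e D_e f(b)D_e f(c) − ½Σ_e [f(c)·ω_e·D_e f(b) + f(b)·ω′_e·D_e f(c)]`,
`ω_e = D_e f(x̂) − [e = x̂]f_nn`, `ω′_e = f(x̂) − f(x̂+e) − [e = −x̂]f_nn` (★ `c0_shell_form`; statement = the typed body of
`C0ShellForm L Δ` with the harmless extra hypothesis `3 ≤ L`, which makes the four neighbour vectors distinct).
Prover seat `hubbard-h0-rotor-p1` g26 (route lead); helper for stmt-HubbardSuperconductivity-23918 (`--supports`, helper class).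
WHAT THIS IS NOT: nothing here proves superconductivity in the Hubbard model; an algebraic identity of ONE row of ONE conditional
reduction.  Tree imports only; no new definitions; no sorry, no axioms.
-/

set_option linter.dupNamespace false
set_option autoImplicit false

noncomputable section

open scoped BigOperators

namespace Summit.HubbardSuperconductivity.HubbardSuperconductivity.Theorems.AnisotropyChord.Transfer.Fibre3

variable (L : ℕ) [NeZero L]

namespace ShellRow

omit [NeZero L] in
/-- the four neighbour vectors are distinct and non-zero for `L ≥ 3`. [folklore] -/
theorem nn_distinct (hL : 3 ≤ L) :
    ex L ≠ 0 ∧ -ex L ≠ ex L ∧ ey L ≠ ex L ∧ -ey L ≠ ex L ∧ ex L ≠ -ex L ∧ ey L ≠ -ex L ∧ -ey L ≠ -ex L := by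
  haveI : NeZero L := ⟨by omega⟩
  have h1 : (1 : ZMod L) ≠ 0 := by
    haveI : Fact (1 < L) := ⟨by omega⟩
    exact one_ne_zero
  have h2 : (1 : ZMod L) ≠ -1 := by
    intro h
    have h2' : ((2 : ℤ) : ZMod L) = 0 := by
      push_cast
      linear_combination h
    rw [ZMod.intCast_zmod_eq_zero_iff_dvd] at h2'
    have := Int.le_of_dvd (by norm_num) h2'
    omega
  have h1' : (0 : ZMod L) ≠ 1 := fun h => h1 h.symm
  have h2' : (-1 : ZMod L) ≠ 1 := fun h => h2 h.symm
  have h3 : (0 : ZMod L) ≠ -1 := by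
    intro h; apply h1; have := congrArg Neg.neg h; simpa using this.symm
  unfold ex ey
  refine ⟨?_, ?_, ?_, ?_, ?_, ?_, ?_⟩ <;> intro h <;> have ha := congrArg Prod.fst h <;>
    simp only [Prod.neg_mk, neg_zero, Prod.fst_zero] at ha
  · exact h1 ha
  · exact h2' ha
  · exact h1' ha
  · exact h1' ha
  · exact h2 ha
  · exact h3 ha
  · exact h3 ha

/-- ★ the SHELL CANCELLATION form of `C0(x̂, b)` (= the body of `C0ShellForm L Δ`, for `L ≥ 3`). [folklore] -/
theorem c0_shell_form (hL : 3 ≤ L) {Δ lam2 : ℝ} {f : Tor L → ℝ} (hf : IsTwoMagnon L Δ lam2 f)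
    (b : Tor L) (hb0 : b ≠ 0) (hb1 : b ≠ ex L) :
    C0fn L Δ lam2 f (ex L, b)
      = f (ex L) / 2 * Dgrad L f (ex L) b ^ 2
        - f (ex L) / 2 * ((nnList L).map (fun e => Dgrad L f e b * Dgrad L f e (b - ex L))).sum
        - (1 / 2 : ℝ) * ((nnList L).map (fun e =>
            f (b - ex L) * (Dgrad L f e (ex L) - if e = ex L then f (ex L) else 0) * Dgrad L f e b
            + f b * (f (ex L) - f (ex L + e) - if e = -ex L then f (ex L) else 0) * Dgrad L f e (b - ex L))).sum := by
  obtain ⟨hex0, ne1, ne2, ne3, ne4, ne5, ne6⟩ := nn_distinct L hL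
  have hD : InD L (ex L, b) = false := by
    unfold InD
    simp [hex0, hb0, Ne.symm hb1]
  rw [c0Explicit_holds L Δ lam2 f hf (ex L, b) hD]
  simp only []
  rw [nnList_map_sum, nnList_map_sum, nnList_map_sum]
  simp only [if_neg ne1, if_neg ne2, if_neg ne3, if_neg ne4, if_neg ne5, if_neg ne6, if_true]
  unfold Dgrad
  simp only [sub_neg_eq_add, sub_add_cancel, neg_neg, sub_zero]
  ring

end ShellRow

end Summit.HubbardSuperconductivity.HubbardSuperconductivity.Theorems.AnisotropyChord.Transfer.Fibre3

end
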